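import Literature.MathematicalPhysics.QuantumFieldTheory.Balaban1983to89.B9Eq349ConjugatedProjection
import Literature.MathematicalPhysics.QuantumFieldTheory.Balaban1983to89.B9Eq325RLipschitzSqrtTower
import Literature.MathematicalPhysics.QuantumFieldTheory.Balaban1983to89.B9Eq364GreenLipschitzFormTower

/-!
# `Balaban1983to89.B9Eq349ConjugatedProjectionChainTower` — T. Bałaban, *Propagators for lattice gauge theories in a background field*, Commun.
# Math. Phys. **99** (1985) 389–434 [Balaban1985BackgroundPropagators] (3.49) p. 399 with (3.21)∕(3.25) p. 394: **THE UNCONJUGATED LETTERS OF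
# `B9Eq349ConjugatedProjection` DISCHARGED FOR PRINT's `k`-LEVEL PROJECTION `P_k(U) = 1 − R_k(U)`** (`R_k(U) = B9Eq326OperatorTower.RofUk`, the
# orthogonal projection onto `Δ^η_U N(Q′_k(U))` on `T_{L^{n+1}m}`) — `P_k x = A_k(T_kx)` with `A_k = G′_k(U)Q̃′_k(U)†` ((3.25) at `k` levels,
# `B9Eq325ProjFormulaTower.RofUk_eq_formula`), `P_k(A_kg) = A_kg` (`B9Eq325RLipschitzSqrtTower.GQk_mem_orthogonal_and_gen`), symmetry, the
# generator certificate `κ₁‖g‖² ≤ ‖A_kg‖²` from the FORM certificate of the third operator (KAPPA1), and `‖D_Uf‖² ≤ re⟪f, Δ′_{a′,k}(U)f⟫`; hence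
# `‖S P_k(U) S⁻¹ x‖ ≤ 2‖x‖` MODULO THE CONJUGATION LETTERS ONLY — the one-storey-up twin of ne9-leaf-06's `B9Eq349ConjugatedProjectionChain`
# (kernel 3 of t4-ne9-idea-1 = `B9Eq349ConjugatedProjection`, unchanged); route R2′ road B8″ row L8 at `k` levels

statement-level skeleton of published theorems with citation tags; proofs where landed; nothing here is a claim about the Yang–Mills mass gap

CITATION HEADER (lean-in-tree rule).  Audit cell `pub-balaban`, sub-cell `t4`, BINDER row NE9; filed by NE9 formalisation-swarm LEAF PROVER 03
(`b2b-balaban-t4-ne9-formalise-leaf-03`, gen 74) as the VERBATIM PORT one storey up of ne9-leaf-06's `B9Eq349ConjugatedProjectionChain` (every statement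
and proof is theirs with `QprimeW ↦ QprimeTowerW`, `GpOfU ↦ GpOfUk`, `RofU ↦ RofUk`, `laplacePrimeA ↦ laplacePrimeAk`; CREDIT theirs and kernel 3's),
composing BY NAME the OWNER's `B9Eq325ProjFormulaTower` (`QGGQk_pos`, `RofUk_eq_formula`), `B9Eq325RLipschitzSqrtTower.GQk_mem_orthogonal_and_gen`,
ne9-leaf-04's `B9Eq364GreenLipschitzFormTower.norm_covDerivL2K_le_sqrt_re_inner_k`, ne9-leaf-06's abstract `B9Eq325ProjFormula.inner_qggq_eq` and
`B9Eq349ConjugatedProjection.norm_conjProj_le_two`.  Source READ in the held text [Balaban1985BackgroundPropagators]: p. 394 (3.21) *«R(U) … the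
orthogonal projection»*, (3.25); p. 398 Thm 3.2 (3.48); p. 399 (3.49).  NOTHING of print's estimates is asserted; the conjugation is the ROUTE's device.

WHAT IS PROVED (sorry-free; proof lane — no `def`; [folklore] composition BY NAME).
* §1 `one_sub_RofUk_apply_eq`, `one_sub_RofUk_fix`, `inner_one_sub_RofUk_left`, `sq_mul_norm_sq_le_norm_GQk_sq`, `sq_norm_covDerivL2K_le_re_inner_k`.
* §2 **`norm_conjProj_one_sub_RofUk_le_two`** — `‖S(S⁻¹x − R_k(U)(S⁻¹x))‖ ≤ 2‖x‖` given `SS⁻¹ = 1`, the dual pairing, the conjugated generators `A±`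
  with `‖A±h − A_kh‖ ≤ δ±‖h‖`, range-projection letters, windows `12δ± ≤ √κ₁`, and the form certificate `κ₁` of `Q̃′_kG′_k²Q̃′_k†`.
HONEST SCOPE.  Symbolic port; `κ₁` and the conjugation letters DISPLAYED (suppliers: this lineage's `B9Eq365QGGQLowerVariationalWindowTower(Diagonal)`
and `B9Eq349ConjugatedDPChainTower`); ONE seam of ONE road, NOT NE9 (cell pub-balaban: NE9 NOT PRINTED ∕ NOT PROVED; «NE9 ⇐ the named binders»; row
WALLED ON A MODEL (O-NE9-1; #5 UNRULED); spine PROVED 0∕9; rung (B)+1 on a finite T⁴ — NOT infinite volume, NOT mass gap, NOT BetaPertH, NOT Clay; HONEST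
DEPENDENCY: continuum YM on T⁴ ⇐ BetaPertH ∧ nine spine estimates (0/9 proved); BetaPertH ⇐ (D1) ∧ (D4) ∧ CAP+tail; G-an2-4 gates asym, D1 and NE2/3/4).
NEW file importing the BUILT `B9Eq349ConjugatedProjection`, `B9Eq325RLipschitzSqrtTower`, `B9Eq364GreenLipschitzFormTower`; nothing modified.  Net new
unproved facts: 0.
-/

noncomputable section

open scoped InnerProductSpace

namespace Literature.MathematicalPhysics.QuantumFieldTheory.Balaban1983to89.B9Eq349ConjugatedProjectionChainTower

open B4Sect5Torus (TSite)
open B9SectCLatticeCarrier (Bond)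
open B9Eq311L2Pairing (WL2)
open B9Eq319QprimeTorus (fineP)
open B11Eq103H1Complex (SiteL2K BondL2K greenK covDerivL2K covLaplaceSiteK projR)
open B9Eq310HessianOperator (adTransportW)
open B9Eq315QTower (towerP)
open B9Eq326OperatorTower (QprimeTowerW RofUk RofUk_isSymmetric)
open B9Eq324DeltaPrimeATower (laplacePrimeAk laplacePrimeAk_apply_of_ker GpOfUk laplacePrimeAk_isSymmetric re_inner_laplacePrimeAk)
open B9Eq325ProjFormula (inner_qggq_eq)
open B9Eq325ProjFormulaTower (QGGQk_pos RofUk_eq_formula)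
open B9Eq325RLipschitzSqrtTower (GQk_mem_orthogonal_and_gen)
open B9Eq364GreenLipschitzFormTower (norm_covDerivL2K_le_sqrt_re_inner_k)
open B9Eq349ConjugatedProjection (norm_conjProj_le_two)

variable {d : ℕ} (L : ℕ) [NeZero L] (m : Fin d → ℕ) [∀ i, NeZero (m i)] (n : ℕ)
  {𝔸 : Type*} [NormedRing 𝔸] [NormedAlgebra ℂ 𝔸] [CompleteSpace 𝔸]
  {W : Type*} [NormedAddCommGroup W] [InnerProductSpace ℂ W] [FiniteDimensional ℂ W] (φ : W ≃ₗ[ℂ] 𝔸) (c₀ : ℝ) [Fact (0 < c₀)]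
  (η : ℝ) (U : Bond d (towerP L m (n + 1)) → 𝔸ˣ) (c₁ : ℝ) [Fact (0 < c₁)] (a' : ℝ)
  (hRS : ∀ (b : Bond d (towerP L m (n + 1))) (v u : W), ⟪adTransportW φ U b v, u⟫_ℂ = ⟪v, adTransportW φ (fun b => (U b)⁻¹) b u⟫_ℂ)
  (hpos' : ∀ x : SiteL2K ℂ d (towerP L m (n + 1)) c₀ W, x ≠ 0 → 0 < RCLike.re ⟪x, laplacePrimeAk L m n φ η U a' (c₁ := c₁) x⟫_ℂ)

/-! ## §1 The four unconjugated letters of `B9Eq349ConjugatedProjection` for `P(U) = 1 − R(U)`, and `hHD` -/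

include hRS in
/-- **`hPA` FOR THE CHAIN**: `f − R(U)f = A(Tf)` with `A = G′(U)Q̃′(U)†`, `Tf = (Q̃′G′²Q̃′†)⁻¹(Q̃′(G′f))` — S3a's `RofU_eq_formula` ((3.25)).
[cite: Balaban1985BackgroundPropagators, (3.25) p.394, (3.49) p.399] -/
theorem one_sub_RofUk_apply_eq (f : SiteL2K ℂ d (towerP L m (n + 1)) c₀ W) :
    f - RofUk L m n φ η U (c₀ := c₀) f =
      (GpOfUk L m n φ η U a' (c₁ := c₁) hpos' ∘ₗ
        LinearMap.adjoint ((WL2.linearEquiv ℂ ℂ (fun _ : TSite d m => c₁)).symm.toLinearMap ∘ₗ QprimeTowerW L m n φ U (c₀ := c₀)))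
        (greenK _ (QGGQk_pos L m n φ c₀ η U c₁ a' hRS hpos')
          (((WL2.linearEquiv ℂ ℂ (fun _ : TSite d m => c₁)).symm.toLinearMap ∘ₗ QprimeTowerW L m n φ U (c₀ := c₀))
            (GpOfUk L m n φ η U a' (c₁ := c₁) hpos' f))) := by
  rw [RofUk_eq_formula L m n φ c₀ η U c₁ a' hRS hpos' f, sub_sub_cancel]
  rfl

include hRS in
/-- **`hfix` FOR THE CHAIN**: `R(U)` kills the range of `A = G′(U)Q̃′(U)†` (it is orthogonal to `Δ_U N(Q′(U))`, leaf-01's `GQ_mem_orthogonal_and_gen`), so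
`Ag − R(U)(Ag) = Ag`. [cite: Balaban1985BackgroundPropagators, (3.21) p.394, (3.25) p.394] -/
theorem one_sub_RofUk_fix (g : SiteL2K ℂ d m c₁ W) :
    (GpOfUk L m n φ η U a' (c₁ := c₁) hpos' ∘ₗ
        LinearMap.adjoint ((WL2.linearEquiv ℂ ℂ (fun _ : TSite d m => c₁)).symm.toLinearMap ∘ₗ QprimeTowerW L m n φ U (c₀ := c₀))) g -
      RofUk L m n φ η U (c₀ := c₀) ((GpOfUk L m n φ η U a' (c₁ := c₁) hpos' ∘ₗ
        LinearMap.adjoint ((WL2.linearEquiv ℂ ℂ (fun _ : TSite d m => c₁)).symm.toLinearMap ∘ₗ QprimeTowerW L m n φ U (c₀ := c₀))) g) =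
      (GpOfUk L m n φ η U a' (c₁ := c₁) hpos' ∘ₗ
        LinearMap.adjoint ((WL2.linearEquiv ℂ ℂ (fun _ : TSite d m => c₁)).symm.toLinearMap ∘ₗ QprimeTowerW L m n φ U (c₀ := c₀))) g := by
  haveI : CompleteSpace ((LinearMap.ker (QprimeTowerW L m n φ U (c₀ := c₀))).map
      (covLaplaceSiteK ((η : ℂ))⁻¹ (adTransportW φ U) (adTransportW φ fun b => (U b)⁻¹))) := FiniteDimensional.complete ℂ _
  have horth := (GQk_mem_orthogonal_and_gen L m n φ c₀ η U c₁ a' hRS hpos').1 g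
  have hR : RofUk L m n φ η U (c₀ := c₀) ((GpOfUk L m n φ η U a' (c₁ := c₁) hpos' ∘ₗ
      LinearMap.adjoint ((WL2.linearEquiv ℂ ℂ (fun _ : TSite d m => c₁)).symm.toLinearMap ∘ₗ QprimeTowerW L m n φ U (c₀ := c₀))) g) = 0 := by
    have e : RofUk L m n φ η U (c₀ := c₀) ((GpOfUk L m n φ η U a' (c₁ := c₁) hpos' ∘ₗ
        LinearMap.adjoint ((WL2.linearEquiv ℂ ℂ (fun _ : TSite d m => c₁)).symm.toLinearMap ∘ₗ QprimeTowerW L m n φ U (c₀ := c₀))) g) =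
        ((LinearMap.ker (QprimeTowerW L m n φ U (c₀ := c₀))).map
          (covLaplaceSiteK ((η : ℂ))⁻¹ (adTransportW φ U) (adTransportW φ fun b => (U b)⁻¹))).starProjection
          ((GpOfUk L m n φ η U a' (c₁ := c₁) hpos' ∘ₗ
            LinearMap.adjoint ((WL2.linearEquiv ℂ ℂ (fun _ : TSite d m => c₁)).symm.toLinearMap ∘ₗ QprimeTowerW L m n φ U (c₀ := c₀))) g) := by
      unfold RofUk B11Eq103H1Complex.RLatticeK projR; rfl
    rw [e, Submodule.starProjection_apply_eq_zero_iff]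
    exact horth
  rw [hR, sub_zero]

omit [Fact (0 < c₁)] in
/-- **`hsa` FOR THE CHAIN**: `1 − R(U)` is symmetric (`R(U)` is an orthogonal projection). [cite: Balaban1985BackgroundPropagators, (3.21) p.394] -/
theorem inner_one_sub_RofUk_left (x y : SiteL2K ℂ d (towerP L m (n + 1)) c₀ W) :
    ⟪x - RofUk L m n φ η U (c₀ := c₀) x, y⟫_ℂ = ⟪x, y - RofUk L m n φ η U (c₀ := c₀) y⟫_ℂ := by
  haveI : CompleteSpace ((LinearMap.ker (QprimeTowerW L m n φ U (c₀ := c₀))).map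
      (covLaplaceSiteK ((η : ℂ))⁻¹ (adTransportW φ U) (adTransportW φ fun b => (U b)⁻¹))) := FiniteDimensional.complete ℂ _
  have e : ∀ z, RofUk L m n φ η U (c₀ := c₀) z = ((LinearMap.ker (QprimeTowerW L m n φ U (c₀ := c₀))).map
      (covLaplaceSiteK ((η : ℂ))⁻¹ (adTransportW φ U) (adTransportW φ fun b => (U b)⁻¹))).starProjection z := fun z => by
    unfold RofUk B11Eq103H1Complex.RLatticeK projR; rfl
  rw [inner_sub_left, inner_sub_right, e, e, Submodule.inner_starProjection_left_eq_right]

include hRS in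
/-- **`hκ₁` FOR THE CHAIN**: a FORM certificate `κ₁‖ψ‖² ≤ re⟪ψ, Q̃′G′(U)²Q̃′†ψ⟫` (NE9 leaf-01's (S3c)∕(S3c♯) at the flat background, or any) is a
GENERATOR certificate `κ₁‖ψ‖² ≤ ‖G′(U)Q̃′(U)†ψ‖²` — S3a's `inner_qggq_eq`. [cite: Balaban1985BackgroundPropagators, Thm 3.2 (3.48) p.398, (3.25) p.394] -/
theorem sq_mul_norm_sq_le_norm_GQk_sq {κ₁ : ℝ}
    (hκ : ∀ ψ : SiteL2K ℂ d m c₁ W, κ₁ * ‖ψ‖ ^ 2 ≤ RCLike.re ⟪ψ,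
      (((WL2.linearEquiv ℂ ℂ (fun _ : TSite d m => c₁)).symm.toLinearMap ∘ₗ QprimeTowerW L m n φ U (c₀ := c₀)) ∘ₗ
        GpOfUk L m n φ η U a' (c₁ := c₁) hpos' ∘ₗ GpOfUk L m n φ η U a' (c₁ := c₁) hpos' ∘ₗ
        LinearMap.adjoint ((WL2.linearEquiv ℂ ℂ (fun _ : TSite d m => c₁)).symm.toLinearMap ∘ₗ QprimeTowerW L m n φ U (c₀ := c₀))) ψ⟫_ℂ)
    (ψ : SiteL2K ℂ d m c₁ W) :
    κ₁ * ‖ψ‖ ^ 2 ≤ ‖(GpOfUk L m n φ η U a' (c₁ := c₁) hpos' ∘ₗ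
      LinearMap.adjoint ((WL2.linearEquiv ℂ ℂ (fun _ : TSite d m => c₁)).symm.toLinearMap ∘ₗ QprimeTowerW L m n φ U (c₀ := c₀))) ψ‖ ^ 2 := by
  have h := hκ ψ
  have e := inner_qggq_eq ((WL2.linearEquiv ℂ ℂ (fun _ : TSite d m => c₁)).symm.toLinearMap ∘ₗ QprimeTowerW L m n φ U (c₀ := c₀))
    (laplacePrimeAk_isSymmetric L m n φ η U a' (c₀ := c₀) (c₁ := c₁) hRS) hpos' ψ
  simp only [LinearMap.comp_apply] at h e ⊢
  unfold GpOfUk at h ⊢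
  rw [e, ← RCLike.ofReal_pow, RCLike.ofReal_re] at h
  exact h

include hRS in
/-- **`hHD` FOR THE CHAIN**: `‖D_Uf‖² ≤ re⟪f, Δ′_{a′}(U)f⟫` (`a′ ≥ 0`; `B9Eq364GreenLipschitzForm.norm_covDerivL2K_le_sqrt_re_inner` squared).
[cite: Balaban1985BackgroundPropagators, (3.24) p.394] -/
theorem sq_norm_covDerivL2K_le_re_inner_k (ha' : 0 ≤ a') (f : SiteL2K ℂ d (towerP L m (n + 1)) c₀ W) :
    ‖covDerivL2K ℂ c₀ ((η : ℂ))⁻¹ (adTransportW φ U) f‖ ^ 2 ≤ RCLike.re ⟪f, laplacePrimeAk L m n φ η U a' (c₁ := c₁) f⟫_ℂ := by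
  have h := norm_covDerivL2K_le_sqrt_re_inner_k L m n φ c₀ η U c₁ a' hRS ha' f
  have h0 : 0 ≤ RCLike.re ⟪f, laplacePrimeAk L m n φ η U a' (c₁ := c₁) f⟫_ℂ := by
    rw [re_inner_laplacePrimeAk L m n φ η U a' hRS f]; positivity
  calc ‖covDerivL2K ℂ c₀ ((η : ℂ))⁻¹ (adTransportW φ U) f‖ ^ 2 ≤ (Real.sqrt (RCLike.re ⟪f, laplacePrimeAk L m n φ η U a' (c₁ := c₁) f⟫_ℂ)) ^ 2 :=
        pow_le_pow_left₀ (norm_nonneg _) h 2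
    _ = _ := Real.sq_sqrt h0

/-! ## §2 `‖S P(U) S⁻¹‖ ≤ 2` for the chain, modulo the conjugation letters -/

section Conj

variable {S Sinv Sd PM PN : SiteL2K ℂ d (towerP L m (n + 1)) c₀ W →ₗ[ℂ] SiteL2K ℂ d (towerP L m (n + 1)) c₀ W}
  {Ap Am : SiteL2K ℂ d m c₁ W →ₗ[ℂ] SiteL2K ℂ d (towerP L m (n + 1)) c₀ W}
  {Tp Tm : SiteL2K ℂ d (towerP L m (n + 1)) c₀ W → SiteL2K ℂ d m c₁ W} {V W' : SiteL2K ℂ d m c₁ W → SiteL2K ℂ d m c₁ W}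

include hRS in
/-- **`‖S P(U) S⁻¹ x‖ ≤ 2‖x‖` FOR THE CHAIN's `P(U) = 1 − R(U)`**, the four unconjugated letters discharged (§1), the conjugation letters displayed: `SS⁻¹ = 1`,
`⟪S^{−†}x, Sy⟫ = ⟪x, y⟫`, `S(Ag) = A₊(Vg)` and `A₋h = S^{−†}(A(W′h))` with `A = G′(U)Q̃′(U)†`, range-projection letters for `P_M` (onto `ran A₊`) and `P_N`
(onto `ran A₋`), `‖A±h − Ah‖ ≤ δ±‖h‖`, windows `12δ± ≤ √κ₁`, and the FORM certificate `κ₁` of `Q̃′G′²Q̃′†` at `U`.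
[cite: Balaban1985BackgroundPropagators, (3.49) p.399, Thm 3.2 (3.48) p.398, (3.25) p.394] -/
theorem norm_conjProj_one_sub_RofUk_le_two {κ₁ : ℝ} (hκ₁0 : 0 < κ₁)
    (hκ : ∀ ψ : SiteL2K ℂ d m c₁ W, κ₁ * ‖ψ‖ ^ 2 ≤ RCLike.re ⟪ψ,
      (((WL2.linearEquiv ℂ ℂ (fun _ : TSite d m => c₁)).symm.toLinearMap ∘ₗ QprimeTowerW L m n φ U (c₀ := c₀)) ∘ₗ
        GpOfUk L m n φ η U a' (c₁ := c₁) hpos' ∘ₗ GpOfUk L m n φ η U a' (c₁ := c₁) hpos' ∘ₗ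
        LinearMap.adjoint ((WL2.linearEquiv ℂ ℂ (fun _ : TSite d m => c₁)).symm.toLinearMap ∘ₗ QprimeTowerW L m n φ U (c₀ := c₀))) ψ⟫_ℂ)
    (hSS : ∀ x, S (Sinv x) = x) (hdual : ∀ x y, ⟪Sd x, S y⟫_ℂ = ⟪x, y⟫_ℂ)
    (hV : ∀ g, S ((GpOfUk L m n φ η U a' (c₁ := c₁) hpos' ∘ₗ
      LinearMap.adjoint ((WL2.linearEquiv ℂ ℂ (fun _ : TSite d m => c₁)).symm.toLinearMap ∘ₗ QprimeTowerW L m n φ U (c₀ := c₀))) g) = Ap (V g))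
    (hPAp : ∀ x, PM x = Ap (Tp x)) (hfixp : ∀ g, PM (Ap g) = Ap g) (hsap : ∀ x y, ⟪PM x, y⟫_ℂ = ⟪x, PM y⟫_ℂ)
    {δp : ℝ} (hδp0 : 0 ≤ δp) (hδp : ∀ h, ‖Ap h - (GpOfUk L m n φ η U a' (c₁ := c₁) hpos' ∘ₗ
      LinearMap.adjoint ((WL2.linearEquiv ℂ ℂ (fun _ : TSite d m => c₁)).symm.toLinearMap ∘ₗ QprimeTowerW L m n φ U (c₀ := c₀))) h‖ ≤ δp * ‖h‖)
    (hwp : 12 * δp ≤ Real.sqrt κ₁)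
    (hAm : ∀ h, Am h = Sd ((GpOfUk L m n φ η U a' (c₁ := c₁) hpos' ∘ₗ
      LinearMap.adjoint ((WL2.linearEquiv ℂ ℂ (fun _ : TSite d m => c₁)).symm.toLinearMap ∘ₗ QprimeTowerW L m n φ U (c₀ := c₀))) (W' h)))
    (hPAm : ∀ x, PN x = Am (Tm x)) (hfixm : ∀ g, PN (Am g) = Am g) (hsam : ∀ x y, ⟪PN x, y⟫_ℂ = ⟪x, PN y⟫_ℂ)
    {δm : ℝ} (hδm0 : 0 ≤ δm) (hδm : ∀ h, ‖Am h - (GpOfUk L m n φ η U a' (c₁ := c₁) hpos' ∘ₗ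
      LinearMap.adjoint ((WL2.linearEquiv ℂ ℂ (fun _ : TSite d m => c₁)).symm.toLinearMap ∘ₗ QprimeTowerW L m n φ U (c₀ := c₀))) h‖ ≤ δm * ‖h‖)
    (hwm : 12 * δm ≤ Real.sqrt κ₁) (x : SiteL2K ℂ d (towerP L m (n + 1)) c₀ W) :
    ‖S (Sinv x - RofUk L m n φ η U (c₀ := c₀) (Sinv x))‖ ≤ 2 * ‖x‖ := by
  have h := norm_conjProj_le_two (𝕜 := ℂ) (P := LinearMap.id - RofUk L m n φ η U (c₀ := c₀))
    (A := GpOfUk L m n φ η U a' (c₁ := c₁) hpos' ∘ₗ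
      LinearMap.adjoint ((WL2.linearEquiv ℂ ℂ (fun _ : TSite d m => c₁)).symm.toLinearMap ∘ₗ QprimeTowerW L m n φ U (c₀ := c₀)))
    (T := fun f => greenK _ (QGGQk_pos L m n φ c₀ η U c₁ a' hRS hpos')
      (((WL2.linearEquiv ℂ ℂ (fun _ : TSite d m => c₁)).symm.toLinearMap ∘ₗ QprimeTowerW L m n φ U (c₀ := c₀)) (GpOfUk L m n φ η U a' (c₁ := c₁) hpos' f)))
    (S := S) (Sinv := Sinv) (Sd := Sd) (Ap := Ap) (Am := Am) (PM := PM) (PN := PN) (Tp := Tp) (Tm := Tm) (V := V) (W' := W')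
    (fun f => by rw [LinearMap.sub_apply, LinearMap.id_apply]; exact one_sub_RofUk_apply_eq L m n φ c₀ η U c₁ a' hRS hpos' f)
    (fun g => by rw [LinearMap.sub_apply, LinearMap.id_apply]; exact one_sub_RofUk_fix L m n φ c₀ η U c₁ a' hRS hpos' g)
    (fun x y => by rw [LinearMap.sub_apply, LinearMap.id_apply, LinearMap.sub_apply, LinearMap.id_apply]; exact inner_one_sub_RofUk_left L m n φ c₀ η U x y)
    hκ₁0 (sq_mul_norm_sq_le_norm_GQk_sq L m n φ c₀ η U c₁ a' hRS hpos' hκ) hSS hdual hV hPAp hfixp hsap hδp0 hδp hwp hAm hPAm hfixm hsam hδm0 hδm hwm x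
  simpa only [LinearMap.sub_apply, LinearMap.id_apply] using h

end Conj

end Literature.MathematicalPhysics.QuantumFieldTheory.Balaban1983to89.B9Eq349ConjugatedProjectionChainTower

end
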